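import Summits.KontsevichZagierPeriods.KontsevichZagierPeriods.Theorems.ZagierDilogarithmConjecture.Negative.Mirror
import Summits.KontsevichZagierPeriods.KontsevichZagierPeriods.Theorems.ZagierDilogarithmConjecture.Negative.DehnWitness
import Summits.KontsevichZagierPeriods.KontsevichZagierPeriods.Theorems.ZagierDilogarithmConjecture.Negative.ConjChars

/-!
# `ZagierDilogarithmConjecture` (stmt-KontsevichZagierPeriods-10550) — negative knowledge VI: the conjugation family `[w] + [w̄]` is load-bearing

`zagier_false_without_conjFamily`: the crux with the relator family `[w] + [w̄]` deleted
(five-term and real relators kept) is FALSE. Witness: the mirror pair `[z₁] − [1 − z̄₁]`,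
`z₁ = 4 + i` (equal volumes, Part I), is outside `AddSubgroup.closure relatorsWithoutConj`
(`mirror_not_mem_closure_relatorsWithoutConj`): with characters `u₁` (killing `ℝ₊` and
`1 − z₁`, `u₁(z₁) = 1`) and `v₁` (killing `ℝ₊`, `v₁(1 − z₁) = 1`) the plain symbol gives
`2 sym(z₁) = 2`. The characters exist because `z₁/z̄₁ = q₁₇ = (4+i)/(4−i)` and
`(1−z₁)/(1−z̄₁) = i q⁻¹` with `q₁₇, q` multiplicatively independent (`indep_q₁₇_q`: coprimality
of `4 + i` with `4 − i`, `2 ± i` in `ℤ[i]`). With Parts I and IV: every hypothesis and both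
non-trivial relator families of the crux are load-bearing. Sorry-free, standard axioms.
-/

noncomputable section

open Complex MeasureTheory Set
open scoped ComplexConjugate

namespace Summit.KontsevichZagierPeriods.HyperbolicBloch.ZagierDilogarithmConjectureNegative

open Literature.NumberTheory.Transcendental
open Summit.KontsevichZagierPeriods.KontsevichZagierPeriods.Theses.HyperbolicBloch
  (ZagierDilogarithmConjecture)
open Summit.KontsevichZagierPeriods.HyperbolicBloch.FiveTermTransferNegative
  (L not_isAlgebraic_L xL xL_re xL_im not_isAlgebraic_xL isAlgebraic_of_eq_rat)

/-! ### The witness `z₁ = 4 + i`, `1 − z₁ = −(3 + i)`; `z₁/z̄₁ = q₁₇`, `(1−z₁)/(1−z̄₁) = i q⁻¹` -/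

/-- `q₁₇ = (4 + i)/(4 − i)`. -/
def q₁₇ : ℂ := (4 + I) / (4 - I)

/-- Auxiliary: `four_add_I_ne_zero`. [folklore] -/
theorem four_add_I_ne_zero : (4 + I : ℂ) ≠ 0 := fun e => by simpa using congrArg Complex.re e
/-- Auxiliary: `four_sub_I_ne_zero`. [folklore] -/
theorem four_sub_I_ne_zero : (4 - I : ℂ) ≠ 0 := fun e => by simpa using congrArg Complex.re e
/-- Auxiliary: `q₁₇_ne_zero`. [folklore] -/
theorem q₁₇_ne_zero : q₁₇ ≠ 0 := div_ne_zero four_add_I_ne_zero four_sub_I_ne_zero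

/-- In `ℤ[i]`, `4 + i` is coprime to `4 − i`, `2 + i` and `2 − i` (Bezout). [folklore] -/
theorem gaussInt_coprime :
    IsCoprime (⟨4, 1⟩ : GaussianInt) ⟨4, -1⟩ ∧ IsCoprime (⟨4, 1⟩ : GaussianInt) ⟨2, -1⟩ ∧
      IsCoprime (⟨4, 1⟩ : GaussianInt) ⟨2, 1⟩ :=
  ⟨⟨⟨2, -1⟩, -2, by decide⟩, ⟨1, ⟨-1, -1⟩, by decide⟩, ⟨⟨0, 1⟩, ⟨0, -2⟩, by decide⟩⟩

/-- `(4+i)^a (2∓i)^c ≠ (4−i)^a (2±i)^c` in `ℤ[i]` for `a ≥ 1`. [folklore] -/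
theorem gaussInt_pow_mul_pow_ne {a c : ℕ} (ha : a ≠ 0) (s : Bool) :
    (⟨4, 1⟩ : GaussianInt) ^ a * (if s then ⟨2, 1⟩ else ⟨2, -1⟩) ^ c ≠
      (⟨4, -1⟩ : GaussianInt) ^ a * (if s then ⟨2, -1⟩ else ⟨2, 1⟩) ^ c := by
  intro e
  obtain ⟨h1, h2, h3⟩ := gaussInt_coprime
  have hdvd : (⟨4, 1⟩ : GaussianInt) ∣ (⟨4, -1⟩ : GaussianInt) ^ a *
      (if s then ⟨2, -1⟩ else ⟨2, 1⟩) ^ c := by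
    rw [← e]
    exact Dvd.dvd.mul_right (dvd_pow_self _ ha) _
  have hcop : IsCoprime (⟨4, 1⟩ : GaussianInt)
      ((⟨4, -1⟩ : GaussianInt) ^ a * (if s then ⟨2, -1⟩ else ⟨2, 1⟩) ^ c) := by
    refine IsCoprime.mul_right h1.pow_right ?_
    cases s
    · simpa using h3.pow_right (n := c)
    · simpa using h2.pow_right (n := c)
  have hunit : IsUnit (⟨4, 1⟩ : GaussianInt) := hcop.isUnit_of_dvd' (dvd_refl _) hdvd
  rw [Zsqrtd.isUnit_iff_norm_isUnit, Zsqrtd.norm_def] at hunit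
  rcases Int.isUnit_iff.mp hunit with h | h <;> norm_num at h

/-- Transfer to `ℂ`: `(4+i)^a (2+i)^c ≠ (4−i)^a (2−i)^c` and `(4+i)^a (2−i)^c ≠ (4−i)^a (2+i)^c`
for `a ≥ 1`. [folklore] -/
theorem complex_pow_mul_pow_ne {a c : ℕ} (ha : a ≠ 0) :
    (4 + I : ℂ) ^ a * (2 + I) ^ c ≠ (4 - I) ^ a * (2 - I) ^ c ∧
      (4 + I : ℂ) ^ a * (2 - I) ^ c ≠ (4 - I) ^ a * (2 + I) ^ c := by
  have t : ∀ (x y : ℤ), GaussianInt.toComplex ⟨x, y⟩ = (x : ℂ) + (y : ℂ) * I := fun x y => by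
    rw [GaussianInt.toComplex_def']
  have e41 : GaussianInt.toComplex ⟨4, 1⟩ = 4 + I := by rw [t]; push_cast; ring
  have e4m : GaussianInt.toComplex ⟨4, -1⟩ = 4 - I := by rw [t]; push_cast; ring
  have e21 : GaussianInt.toComplex ⟨2, 1⟩ = 2 + I := by rw [t]; push_cast; ring
  have e2m : GaussianInt.toComplex ⟨2, -1⟩ = 2 - I := by rw [t]; push_cast; ring
  constructor
  · intro e
    apply gaussInt_pow_mul_pow_ne (c := c) ha true
    apply GaussianInt.toComplex_injective
    simp only [↓reduceIte, map_mul, map_pow, e41, e4m, e21, e2m]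
    exact e
  · intro e
    apply gaussInt_pow_mul_pow_ne (c := c) ha false
    apply GaussianInt.toComplex_injective
    simp only [Bool.false_eq_true, ↓reduceIte, map_mul, map_pow, e41, e4m, e21, e2m]
    exact e

/-- **Multiplicative independence of `q₁₇` and `q`**: `q₁₇ ^ a * q ^ c = 1 → a = 0`. [folklore] -/
theorem indep_q₁₇_q {a c : ℤ} (h : q₁₇ ^ a * q ^ c = 1) : a = 0 := by
  by_contra ha
  -- reduce to a > 0
  wlog hpos : 0 < a generalizing a c
  · have ha' : -a ≠ 0 := neg_ne_zero.mpr ha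
    have hneg : 0 < -a := by omega
    refine this (a := -a) (c := -c) ?_ ha' hneg
    rw [zpow_neg, zpow_neg, ← mul_inv, h, inv_one]
  obtain ⟨n, rfl⟩ := Int.eq_ofNat_of_zero_le hpos.le
  have hn : n ≠ 0 := by omega
  -- clear the denominators (4 - i)^n and (2 ∓ i)^{|c|}
  unfold q₁₇ q at h
  rw [zpow_natCast, div_pow] at h
  rcases Int.natAbs_eq c with hc | hc <;> rw [hc] at h
  · rw [zpow_natCast, div_pow, div_mul_div_comm, div_eq_one_iff_eq
      (mul_ne_zero (pow_ne_zero _ four_sub_I_ne_zero) (pow_ne_zero _ two_sub_I_ne_zero))] at h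
    exact (complex_pow_mul_pow_ne (c := c.natAbs) hn).1 h
  · rw [zpow_neg, zpow_natCast, div_pow, inv_div, div_mul_div_comm, div_eq_one_iff_eq
      (mul_ne_zero (pow_ne_zero _ four_sub_I_ne_zero) (pow_ne_zero _ two_add_I_ne_zero))] at h
    exact (complex_pow_mul_pow_ne (c := c.natAbs) hn).2 h

/-- The witness `z₁ = 4 + i`. -/
def z₁ : ℂ := 4 + I

/-- Auxiliary: `z₁_ne_zero`. [folklore] -/
theorem z₁_ne_zero : z₁ ≠ 0 := four_add_I_ne_zero
/-- Auxiliary: `one_sub_z₁`. [folklore] -/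
theorem one_sub_z₁ : 1 - z₁ = -(3 + I) := by rw [z₁]; ring
/-- Auxiliary: `three_add_I_ne_zero`. [folklore] -/
theorem three_add_I_ne_zero : (3 + I : ℂ) ≠ 0 := fun e => by simpa using congrArg Complex.re e
/-- Auxiliary: `one_sub_z₁_ne_zero`. [folklore] -/
theorem one_sub_z₁_ne_zero : 1 - z₁ ≠ 0 := by rw [one_sub_z₁]; exact neg_ne_zero.mpr three_add_I_ne_zero

/-- `z₁ / z̄₁ = q₁₇`. [folklore] -/
theorem z₁_div_conj : z₁ / conj z₁ = q₁₇ := by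
  rw [z₁, q₁₇, map_add, map_ofNat, Complex.conj_I, ← sub_eq_add_neg]

/-- `(1 − z₁)/(1 − z̄₁) = i · q⁻¹`. [folklore] -/
theorem one_sub_z₁_div_conj : (1 - z₁) / conj (1 - z₁) = I * q⁻¹ := by
  have h1 : conj (1 - z₁) = -(3 - I) := by
    rw [one_sub_z₁, map_neg, map_add, map_ofNat, Complex.conj_I, sub_eq_add_neg]
  have h3 : (3 - I : ℂ) ≠ 0 := fun e => by simpa using congrArg Complex.re e
  rw [h1, one_sub_z₁, neg_div_neg_eq, q, inv_div, mul_div_assoc', div_eq_div_iff h3 two_add_I_ne_zero]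
  apply Complex.ext <;> simp <;> norm_num

/-- `(x ^ M) ^ 4 = x ^ (M * 4)` for integer `M`. [folklore] -/
theorem zpow_pow_four (x : ℂ) (M : ℤ) : (x ^ M) ^ 4 = x ^ (M * 4) := by
  rw [← zpow_natCast (x ^ M) 4, ← zpow_mul]
  norm_cast

/-- `(i ^ b) ^ 4 = 1` for integer `b`. [folklore] -/
theorem I_zpow_pow_four (b : ℤ) : (I ^ b) ^ 4 = 1 := by
  rw [zpow_pow_four, mul_comm, zpow_mul]
  have h4 : (I : ℂ) ^ (4 : ℤ) = 1 := by
    rw [show (4 : ℤ) = ((4 : ℕ) : ℤ) by norm_num, zpow_natCast, Complex.I_pow_four]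
  rw [h4, one_zpow]

/-- Generators of `Additive ℂˣ` at `z₁` and `1 − z₁`. -/
def gz₁ : Additive ℂˣ := Additive.ofMul (Units.mk0 z₁ z₁_ne_zero)
/-- See `gz₁`. -/
def gw₁ : Additive ℂˣ := Additive.ofMul (Units.mk0 (1 - z₁) one_sub_z₁_ne_zero)

/-- Reading `M • [w] ∈ posReal ⊔ ℤ[w']` multiplicatively: `w ^ M = r * w' ^ b`, `r > 0`. [folklore] -/
theorem smul_mem_sup_span {w w' : ℂ} (hw : w ≠ 0) (hw' : w' ≠ 0) {M : ℤ}
    (h : M • Additive.ofMul (Units.mk0 w hw) ∈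
      posRealSubmodule ⊔ Submodule.span ℤ {Additive.ofMul (Units.mk0 w' hw')}) :
    ∃ (r : ℝ) (b : ℤ), 0 < r ∧ w ^ M = r * w' ^ b := by
  rw [Submodule.mem_sup] at h
  obtain ⟨p, hp, y, hy, hpy⟩ := h
  obtain ⟨b, rfl⟩ := Submodule.mem_span_singleton.mp hy
  obtain ⟨r, hr, hpr⟩ := hp
  refine ⟨r, b, hr, ?_⟩
  have e := congrArg (fun t : Additive ℂˣ => ((Additive.toMul t : ℂˣ) : ℂ)) hpy
  simp only [toMul_add, toMul_zsmul, Units.val_mul, Units.val_zpow_eq_zpow_val] at e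
  rw [hpr] at e
  simpa using e.symm

/-- If `w^M = r · w'^b` with `r > 0` then `(w/w̄)^M = (w'/w̄')^b`. [folklore] -/
theorem div_conj_zpow_eq {w w' : ℂ} (hw : w ≠ 0) (hw' : w' ≠ 0) {M b : ℤ} {r : ℝ} (hr : 0 < r)
    (h : w ^ M = r * w' ^ b) : (w / conj w) ^ M = (w' / conj w') ^ b := by
  have hc := congrArg conj h
  simp only [map_zpow₀, map_mul, Complex.conj_ofReal] at hc
  have hr' : (r : ℂ) ≠ 0 := by exact_mod_cast hr.ne'
  have hcw : conj w ≠ 0 := (map_ne_zero _).mpr hw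
  have hcw' : conj w' ≠ 0 := (map_ne_zero _).mpr hw'
  rw [div_zpow, div_zpow, div_eq_div_iff (zpow_ne_zero _ hcw) (zpow_ne_zero _ hcw'), h, hc]
  ring

/-- Condition for `u`: no non-zero multiple of `[z₁]` lies in `posReal ⊔ ℤ[1 − z₁]`. [folklore] -/
theorem smul_gz₁_notMem (M : ℤ)
    (h : M • gz₁ ∈ posRealSubmodule ⊔ Submodule.span ℤ {gw₁}) : M = 0 := by
  obtain ⟨r, b, hr, e⟩ := smul_mem_sup_span z₁_ne_zero one_sub_z₁_ne_zero h
  have e2 := div_conj_zpow_eq z₁_ne_zero one_sub_z₁_ne_zero hr e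
  rw [z₁_div_conj, one_sub_z₁_div_conj, mul_zpow] at e2
  have e4 : (q₁₇ ^ M) ^ 4 = (I ^ b) ^ 4 * (q⁻¹ ^ b) ^ 4 := by rw [← mul_pow, e2]
  rw [I_zpow_pow_four, one_mul, inv_zpow', zpow_pow_four, zpow_pow_four] at e4
  have key : q₁₇ ^ (M * 4) * q ^ (b * 4) = 1 := by
    rw [e4, ← zpow_add₀ q_ne_zero, show -b * 4 + b * 4 = 0 by ring, zpow_zero]
  have := indep_q₁₇_q key
  omega

/-- Condition for `v`: no non-zero multiple of `[1 − z₁]` is a positive real. [folklore] -/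
theorem smul_gw₁_notMem (M : ℤ) (h : M • gw₁ ∈ posRealSubmodule) : M = 0 := by
  obtain ⟨r, hr, e⟩ := h
  have e1 : (1 - z₁) ^ M = r := by
    simpa [gw₁, toMul_zsmul, Units.val_zpow_eq_zpow_val] using e
  have e2 : ((1 - z₁) / conj (1 - z₁)) ^ M = 1 := by
    have hc := congrArg conj e1
    rw [map_zpow₀, Complex.conj_ofReal] at hc
    rw [div_zpow, e1, hc, div_self]
    exact_mod_cast hr.ne'
  rw [one_sub_z₁_div_conj, mul_zpow] at e2
  have e4 : (I ^ M) ^ 4 * (q⁻¹ ^ M) ^ 4 = 1 := by rw [← mul_pow, e2, one_pow]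
  rw [I_zpow_pow_four, one_mul, inv_zpow', zpow_pow_four] at e4
  have := q_zpow_eq_one e4
  omega

/-- The characters: `u₁` kills the positive reals and `1 − z₁`, `u₁(z₁) = 1`; `v₁` kills the
positive reals, `v₁(1 − z₁) = 1`. [folklore] -/
theorem exists_u₁ : ∃ u : Additive ℂˣ →+ ℚ,
    (∀ y ∈ posRealSubmodule, u y = 0) ∧ u gw₁ = 0 ∧ u gz₁ = 1 := by
  obtain ⟨φ, h0, h1⟩ := exists_addMonoidHom_eq_one_of_forall_smul_notMem
    (posRealSubmodule ⊔ Submodule.span ℤ {gw₁}) gz₁ smul_gz₁_notMem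
  exact ⟨φ, fun y hy => h0 y (Submodule.mem_sup_left hy),
    h0 _ (Submodule.mem_sup_right (Submodule.subset_span rfl)), h1⟩

/-- See `exists_u₁`. [folklore] -/
theorem exists_v₁ : ∃ v : Additive ℂˣ →+ ℚ, (∀ y ∈ posRealSubmodule, v y = 0) ∧ v gw₁ = 1 := by
  obtain ⟨φ, h0, h1⟩ := exists_addMonoidHom_eq_one_of_forall_smul_notMem posRealSubmodule gw₁
    smul_gw₁_notMem
  exact ⟨φ, h0, h1⟩

/-- The chosen characters. -/
def u₁ : Additive ℂˣ →+ ℚ := exists_u₁.choose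
/-- See `u₁`. -/
def v₁ : Additive ℂˣ →+ ℚ := exists_v₁.choose

/-- Auxiliary: `u₁_pos`. [folklore] -/
theorem u₁_pos : ∀ y ∈ posRealSubmodule, u₁ y = 0 := exists_u₁.choose_spec.1
/-- Auxiliary: `v₁_pos`. [folklore] -/
theorem v₁_pos : ∀ y ∈ posRealSubmodule, v₁ y = 0 := exists_v₁.choose_spec.1
/-- Auxiliary: `ext_u₁_w₁`. [folklore] -/
theorem ext_u₁_w₁ : ext u₁ (1 - z₁) = 0 := by
  rw [ext_of_ne u₁ one_sub_z₁_ne_zero]; exact exists_u₁.choose_spec.2.1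
/-- Auxiliary: `ext_u₁_z₁`. [folklore] -/
theorem ext_u₁_z₁ : ext u₁ z₁ = 1 := by
  rw [ext_of_ne u₁ z₁_ne_zero]; exact exists_u₁.choose_spec.2.2
/-- Auxiliary: `ext_v₁_w₁`. [folklore] -/
theorem ext_v₁_w₁ : ext v₁ (1 - z₁) = 1 := by
  rw [ext_of_ne v₁ one_sub_z₁_ne_zero]; exact exists_v₁.choose_spec.2

/-- `sym u₁ v₁ z₁ = 1`. [folklore] -/
theorem sym_z₁ : sym u₁ v₁ z₁ = 1 := by
  simp [sym, ext_u₁_z₁, ext_u₁_w₁, ext_v₁_w₁]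

/-- **The mirror element `[4 + i] − [−3 + i]` is outside the span of the five-term and real
relators**: the conjugation family `[w] + [w̄]` of the crux is load-bearing. [folklore] -/
theorem mirror_not_mem_closure_relatorsWithoutConj :
    FreeAbelianGroup.of z₁ - FreeAbelianGroup.of (1 - conj z₁) ∉
      AddSubgroup.closure relatorsWithoutConj := by
  intro h
  have h0 := psym_eq_zero_of_mem_closure u₁_pos v₁_pos h
  rw [map_sub, psym_of, psym_of] at h0
  have e : sym u₁ v₁ (1 - conj z₁) = -sym u₁ v₁ z₁ := by
    have h1 : 1 - conj z₁ = conj (1 - z₁) := by simp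
    rw [h1, sym_conj u₁_pos v₁_pos]
    simp only [sym, sub_sub_cancel]
    ring
  rw [e, sym_z₁] at h0
  norm_num at h0

/-! ### The crux without the conjugation family is FALSE -/

/-- **The crux with the relator family `[w] + [w̄]` (`w` algebraic) deleted** (five-term and
real relators kept). -/
def ZagierWithoutConjFamily : Prop :=
  ∀ (k : ℕ) (z : Fin k → ℂ) (n : Fin k → ℤ), (∀ i, IsAlgebraic ℚ (z i)) → (∀ i, 0 < (z i).im) →
    ∑ i, (n i : ℝ) * idealTetrahedronVolume (z i) = 0 →
      (∑ i, n i • FreeAbelianGroup.of (z i)) ∈ AddSubgroup.closure relatorsWithoutConj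

/-- Auxiliary: `isAlgebraic_z₁`. [folklore] -/
theorem isAlgebraic_z₁ : IsAlgebraic ℚ z₁ := isAlgebraic_of_eq_rat 4 1 (by rw [z₁]; push_cast; ring)

/-- Auxiliary: `isAlgebraic_one_sub_conj_z₁`. [folklore] -/
theorem isAlgebraic_one_sub_conj_z₁ : IsAlgebraic ℚ (1 - conj z₁) :=
  isAlgebraic_of_eq_rat (-3) 1 (by rw [z₁, map_add, map_ofNat, Complex.conj_I]; push_cast; ring)

/-- **Any proof must use the conjugation relators `[w] + [w̄]`**: with only the five-term and
real families, the mirror relation `vol T(4 + i) = vol T(−3 + i)` is unexplained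
(`mirror_not_mem_closure_relatorsWithoutConj`). Together with `zagier_false_without_fiveTerm`
(Part I) this shows the two non-trivial relator families are both needed; dropping the real family
alone is not settled here (it is redundant up to 2-torsion: `2[r] = [r] + [r̄]`). [folklore] -/
theorem zagier_false_without_conjFamily : ¬ ZagierWithoutConjFamily := by
  intro h
  have halg : ∀ j : Fin 2, IsAlgebraic ℚ ((![z₁, 1 - conj z₁] : Fin 2 → ℂ) j) := by
    intro j; fin_cases j
    · exact isAlgebraic_z₁
    · exact isAlgebraic_one_sub_conj_z₁
  have him : ∀ j : Fin 2, 0 < ((![z₁, 1 - conj z₁] : Fin 2 → ℂ) j).im := by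
    intro j; fin_cases j <;> simp [z₁]
  have hvol : ∑ j : Fin 2, ((![1, -1] : Fin 2 → ℤ) j : ℝ) *
      idealTetrahedronVolume ((![z₁, 1 - conj z₁] : Fin 2 → ℂ) j) = 0 := by
    simp [Fin.sum_univ_two, idealTetrahedronVolume_one_sub_conj]
  have hmem := h 2 ![z₁, 1 - conj z₁] ![1, -1] halg him hvol
  apply mirror_not_mem_closure_relatorsWithoutConj
  have e : ∑ j : Fin 2, (![1, -1] : Fin 2 → ℤ) j •
      FreeAbelianGroup.of ((![z₁, 1 - conj z₁] : Fin 2 → ℂ) j) =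
      FreeAbelianGroup.of z₁ - FreeAbelianGroup.of (1 - conj z₁) := by
    rw [Fin.sum_univ_two]
    simp only [Matrix.cons_val_zero, Matrix.cons_val_one, Matrix.cons_val_fin_one, one_smul,
      neg_smul, ← sub_eq_add_neg]
  rw [← e]
  exact hmem

end Summit.KontsevichZagierPeriods.HyperbolicBloch.ZagierDilogarithmConjectureNegative

end
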